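import Summits.ValiantsHypothesis.ValiantsHypothesis.Theses.SOSTau
import Literature.Computability.AlgebraicComplexity.RealTauKnownCases

/-!
# ValiantsHypothesis / SOSTau — item `SameSignSquares` (stmt-ValiantsHypothesis-18754)

A weighted sum of squares `Σ_i a_i g_i²` with all weights `a_i ≥ 0` has at most `2 Σ_i |supp g_i|`
distinct real zeros: if the sum is a nonzero polynomial, some term has `a_{i₀} > 0` and `g_{i₀} ≠ 0`,
every real zero of the sum is a zero of every term, in particular of `g_{i₀}`, and a polynomial with
`t` monomials has at most `2(t-1)+1 ≤ 2t` distinct real zeros (sparse Descartes,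
`Literature.Computability.AlgebraicComplexity.card_roots_toFinset_le_of_card_support`).
HONEST FRAMING: an elementary support lemma of a dormant route; nothing here bears on `VP ≠ VNP`.
-/

-- layout Summits/ValiantsHypothesis/ValiantsHypothesis forces the duplicated namespace component
set_option linter.dupNamespace false

namespace Summit.ValiantsHypothesis.ValiantsHypothesis.Theorems.SOSTau

open Polynomial Finset

/-- **Item `SameSignSquares` (stmt-ValiantsHypothesis-18754).** [folklore] -/
theorem sameSignSquares_proof : Theses.SOSTau.SameSignSquares := by
  unfold Theses.SOSTau.SameSignSquares
  intro s a g ha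
  classical
  set P : ℝ[X] := ∑ i, Polynomial.C (a i) * g i ^ 2 with hP
  by_cases hP0 : P = 0
  · rw [hP0, Polynomial.roots_zero, Multiset.toFinset_zero, Finset.card_empty]
    exact Nat.zero_le _
  -- a term with positive weight and nonzero square
  obtain ⟨i₀, ha0, hg0⟩ : ∃ i₀, a i₀ ≠ 0 ∧ g i₀ ≠ 0 := by
    by_contra h
    push Not at h
    apply hP0
    rw [hP]
    refine Finset.sum_eq_zero fun i _ => ?_
    by_cases hai : a i = 0
    · rw [hai, map_zero, zero_mul]
    · rw [h i hai, zero_pow two_ne_zero, mul_zero]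
  -- every real zero of `P` is a zero of `g i₀`
  have hsub : P.roots.toFinset ⊆ (g i₀).roots.toFinset := by
    intro x hx
    rw [Multiset.mem_toFinset, Polynomial.mem_roots hP0, Polynomial.IsRoot.def, hP,
      Polynomial.eval_finsetSum] at hx
    simp only [Polynomial.eval_mul, Polynomial.eval_C, Polynomial.eval_pow] at hx
    have hterm := (Finset.sum_eq_zero_iff_of_nonneg fun i _ =>
      mul_nonneg (ha i) (sq_nonneg ((g i).eval x))).1 hx i₀ (Finset.mem_univ _)
    rcases mul_eq_zero.1 hterm with h | h
    · exact (ha0 h).elim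
    · rw [Multiset.mem_toFinset, Polynomial.mem_roots hg0, Polynomial.IsRoot.def]
      exact pow_eq_zero_iff two_ne_zero |>.1 h
  calc P.roots.toFinset.card ≤ (g i₀).roots.toFinset.card := Finset.card_le_card hsub
    _ ≤ 2 * ((g i₀).support.card - 1) + 1 :=
        Literature.Computability.AlgebraicComplexity.card_roots_toFinset_le_of_card_support hg0
    _ ≤ 2 * (g i₀).support.card := by
        have : 0 < (g i₀).support.card := Finset.card_pos.2 (Polynomial.support_nonempty.2 hg0)
        omega
    _ ≤ 2 * ∑ i, (g i).support.card :=
        Nat.mul_le_mul_left _ (Finset.single_le_sum (f := fun i => (g i).support.card)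
          (fun i _ => Nat.zero_le _) (Finset.mem_univ i₀))

end Summit.ValiantsHypothesis.ValiantsHypothesis.Theorems.SOSTau
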